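import Summits.CriticalPhenomena.PercolationContinuityZ3.Theorems.PercNearOneGluingNoHeavyPcintBFibAssembly
import Summits.CriticalPhenomena.PercolationContinuityZ3.Theorems.PercNearOneGluingNoHeavyPcintBFibCheck
import HarnessLib

/-!
# PCINT lane, T-fibre route PHASE 3 (bond), step (8): the bond criterion for complete bipartite fibres

Cell `prim-pcint`, seat `prim-pcint-1` (gen 13); memo `run/shared/lean/prim/pcint/T-FIBRE-ROUTE.md` (PHASE 3).

Puts together, for the complete bipartite fibre `K_{n,n} = UFib.bipGraph SA` (`#SA = #SAᶜ = n`): the growth data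
(edge key `ekB`, breadth-first growth rule `growB SA D` of depth `D`, soundness `growB_sound`, connectedness
`UFib.bipGraph_conn`), its size law (`sum_wt_card_growB`: `lawA p D 0 1 (n-1) n`, independent of the entry cell), the criterion
`BFib.criticalProb_lfib_le_of_table` and the kernel check `BFib.checkBond`:

  **`BFib.criticalProb_lfib_bip_le`**: `checkBond n D (P/10⁴) (3473/10⁴) = true → p_c^bond(𝕋 × K_{n,n}) ≤ P/10⁴`.
-/

noncomputable section

namespace Summit.CriticalPhenomena.PercolationContinuityZ3.Theorems.Pcint

namespace BFib

open Finset AdaptDom UFib Literature.Probability.Percolation Literature.Probability.LatticeModels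

variable {Φ : Type} [Fintype Φ] [DecidableEq Φ] (SA : Finset Φ)

/-- **The bond criterion for `𝕋 × K_{n,n}`**: a passed kernel check `checkBond n D (P/10⁴) (3473/10⁴)` gives
`p_c^bond(𝕋 × K_{n,n})((0, i₀)) ≤ P/10⁴`. -/
theorem criticalProb_lfib_bip_le {n : ℕ} (hA : SA.card = n) (hB : SAᶜ.card = n) (i₀ : Φ) (hi₀ : i₀ ∈ SA) (b₀ : Φ)
    (hb₀ : b₀ ∉ SA) (D P : ℕ) (hP0 : 0 < P) (hP1 : P ≤ 10000)
    (h : checkBond n D ((P : ℚ) / 10000) (3473 / 10000) = true) :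
    criticalProb (lfib (bipGraph SA)) ((0 : Site 2), i₀) ≤ (P : ℝ) / 10000 := by
  have hn : 1 ≤ n := by rw [← hA]; exact card_pos.2 ⟨i₀, hi₀⟩
  have hcardΦ : Fintype.card Φ = 2 * n := by rw [← Finset.card_add_card_compl SA, hA, hB]; ring
  obtain ⟨hroot, htable⟩ := table_of_checkBond h hn
  have hp : (((P : ℚ) / 10000 : ℚ) : ℝ) = (P : ℝ) / 10000 := by push_cast; ring
  have hs : (((3473 : ℚ) / 10000 : ℚ) : ℝ) = (3473 : ℝ) / 10000 := by push_cast; ring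
  rw [hp, hs] at hroot htable
  have hP0' : (0 : ℝ) < (P : ℝ) / 10000 := by positivity
  have hP1' : (P : ℝ) / 10000 ≤ 1 := by
    rw [div_le_one (by norm_num)]; exact_mod_cast hP1
  exact criticalProb_lfib_le_of_table (FA := bipGraph SA) (ek := ekB SA) (grow := growB SA D) (i₀ := i₀)
    (fun _ _ h => ekB_comm h) (fun a b _ => ekB_mem a b) (fun y i j hj => growB_sound D y i j hj) (bipGraph_conn hi₀ hb₀)
    ((P : ℝ) / 10000) hP0' hP1' (fun u => lawA ((P : ℝ) / 10000) D 0 1 (n - 1) n u)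
    (fun i G => sum_wt_card_growB ((P : ℝ) / 10000) hA hB D i G)
    (by rw [hcardΦ]; exact hroot) (by rw [hcardΦ]; exact htable)

end BFib

end Summit.CriticalPhenomena.PercolationContinuityZ3.Theorems.Pcint

end
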